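import Summits.AtomisticToContinuum.BoseEinsteinCondensation.Theorems.BECTangentRigidityRigidMomentumBoundStubInsertionBound
import Literature.MathematicalPhysics.QuantumManyBody.BoseGasInsertionScaling
import HarnessLib

/-!
# Crux `GroundStateRigidity` (stmt-AtomisticToContinuum-9072), lines `loose_pricing` /
# `zoo_reduction`: the registered stub `stub_cellInsertion`

Supports (does not close) stmt-AtomisticToContinuum-9072; registered stub `stub_cellInsertion`
(Stub C of line `loose_pricing` = Stub INS of line `zoo_reduction`; lead c5). **The cell insertion
bound.** There is an absolute `C_I > 0` (here `C_I = 31`) such that for a measurable pair profile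
`v ≥ 0` of range `R₀ ≥ 0` (`v = 0` beyond `R₀`, anything — `⊤` included — below) and every cell scale
`s > 0` with `4 R₀ ≤ s` and `128 (N+1) s³ ≤ L³`: `E₀(N+1, L) ≤ E₀(N, L) + C_I/s²`.

## Proof

Not by the cell construction of the line card but as a corollary of the tree's landed
chemical-potential bound for the crux `RigidMomentumBound`:
`RigidMomentumBound.InsertionBound.insertionBound_range_two` (range `2`, Dyson's Jastrow-dressed
insertion, LSSY2005 Thm 2.2) rescaled to the range `s/4 ≥ R₀` by the exact dilation covariance
`InsertionScaling.insertionBound_of_fixedRange`: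
`E₀(N+1, L) ≤ E₀(N, L) + 120/L² + 13000·N·(s/4)/L³` whenever `N (s/4)³ ≤ L³/2000`, which follows
from `128 (N+1) s³ ≤ L³` (`2000/64 < 128`). Moreover `L³ ≥ 128 s³ > (5s)³` gives `L ≥ 5s`, so
`120/L² ≤ 5/s²`, and `3250 N s/L³ ≤ 3250 N s/(128 (N+1) s³) ≤ 26/s²`; total `≤ 31/s²`.
(`L > 0` is forced by `0 < 128 (N+1) s³ ≤ L³`.)
-/

noncomputable section

open MeasureTheory Filter Metric
open scoped ENNReal NNReal Topology

namespace Summit.AtomisticToContinuum.BoseEinsteinCondensation.Theorems.GroundStateRigidity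

open Literature.MathematicalPhysics.QuantumManyBody.BoseGas

namespace CellInsertion

/-- The chemical-potential bound at an arbitrary range `c > 0`: if `v = 0` beyond `c`, `L > 0` and
`N c³ ≤ L³/2000`, then `E₀(N+1, L) ≤ E₀(N, L) + 120/L² + 13000·N·c/L³`
(`RigidMomentumBound.InsertionBound.insertionBound_range_two` rescaled by
`InsertionScaling.insertionBound_of_fixedRange`). [cite: LSSY2005, Thm 2.2 (2.17)–(2.26)] -/
theorem insertionBound_range {v : ℝ → ℝ≥0∞} (hv : Measurable v) {c : ℝ} (hc : 0 < c)
    (hvc : ∀ r, c < r → v r = 0) (N : ℕ) {L : ℝ} (hL : 0 < L)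
    (hNL : (N : ℝ) * c ^ 3 ≤ L ^ 3 / 2000) :
    groundStateEnergy v (N + 1) L ≤
      groundStateEnergy v N L + ENNReal.ofReal (120 / L ^ 2 + 13000 * N * c / L ^ 3) :=
  InsertionScaling.insertionBound_of_fixedRange (c := 2) (A := 120) (B := 13000) two_pos
    (fun v hv hv2 N L hL hNL =>
      RigidMomentumBound.InsertionBound.insertionBound_range_two v hv hv2 N L hL hNL)
    hv hc hvc N hL hNL

/-- `L > 0` is forced by `0 < s` and `128 (N+1) s³ ≤ L³`. [folklore] -/
theorem pos_of_density {N : ℕ} {s L : ℝ} (hs : 0 < s)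
    (hNL : 128 * ((N : ℝ) + 1) * s ^ 3 ≤ L ^ 3) : 0 < L := by
  have h0 : (0 : ℝ) < 128 * ((N : ℝ) + 1) * s ^ 3 := by positivity
  exact (Odd.pow_pos_iff (by decide : Odd 3)).1 (h0.trans_le hNL)

/-- The density hypothesis at range `s/4`: `128 (N+1) s³ ≤ L³` gives `N (s/4)³ ≤ L³/2000`.
[folklore] -/
theorem density_of_cell {N : ℕ} {s L : ℝ} (hs : 0 < s)
    (hNL : 128 * ((N : ℝ) + 1) * s ^ 3 ≤ L ^ 3) : (N : ℝ) * (s / 4) ^ 3 ≤ L ^ 3 / 2000 := by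
  have h0 : (0 : ℝ) ≤ N * s ^ 3 := by positivity
  have h1 : (0 : ℝ) ≤ s ^ 3 := by positivity
  rw [le_div_iff₀ (by norm_num : (0 : ℝ) < 2000)]
  calc (N : ℝ) * (s / 4) ^ 3 * 2000 = 125 / 4 * (N * s ^ 3) := by ring
    _ ≤ 128 * ((N : ℝ) + 1) * s ^ 3 := by nlinarith
    _ ≤ L ^ 3 := hNL

/-- The numerical step: for `0 < s`, `0 < L` and `128 (N+1) s³ ≤ L³`,
`120/L² + 13000·N·(s/4)/L³ ≤ 31/s²` (`L ≥ 5s` as `5³ = 125 ≤ 128`). [folklore] -/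
theorem numeric_bound {N : ℕ} {s L : ℝ} (hs : 0 < s) (hL : 0 < L)
    (hNL : 128 * ((N : ℝ) + 1) * s ^ 3 ≤ L ^ 3) :
    120 / L ^ 2 + 13000 * N * (s / 4) / L ^ 3 ≤ 31 / s ^ 2 := by
  have hN : (0 : ℝ) ≤ N := Nat.cast_nonneg N
  have hs2 : 0 < s ^ 2 := by positivity
  have hs3 : 0 < s ^ 3 := by positivity
  have hL3 : 0 < L ^ 3 := by positivity
  have h0 : (0 : ℝ) ≤ N * s ^ 3 := by positivity
  -- `L ≥ 5 s`
  have hcube : (5 * s) ^ 3 ≤ L ^ 3 := by nlinarith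
  have h5 : 5 * s ≤ L := le_of_pow_le_pow_left₀ (by norm_num) hL.le hcube
  have hsq : 25 * s ^ 2 ≤ L ^ 2 := by nlinarith
  have hA : 120 / L ^ 2 ≤ 5 / s ^ 2 := by
    rw [div_le_div_iff₀ (by positivity) hs2]
    nlinarith
  have hB : 13000 * N * (s / 4) / L ^ 3 ≤ 26 / s ^ 2 := by
    rw [div_le_div_iff₀ hL3 hs2]
    calc 13000 * N * (s / 4) * s ^ 2 = 3250 * (N * s ^ 3) := by ring
      _ ≤ 26 * (128 * ((N : ℝ) + 1) * s ^ 3) := by nlinarith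
      _ ≤ 26 * L ^ 3 := by gcongr
  calc 120 / L ^ 2 + 13000 * N * (s / 4) / L ^ 3 ≤ 5 / s ^ 2 + 26 / s ^ 2 := add_le_add hA hB
    _ = 31 / s ^ 2 := by ring

end CellInsertion

open CellInsertion in
/-- **Stub `stub_cellInsertion` (Stub C of line `loose_pricing`, Stub INS of line `zoo_reduction`) of
the crux `GroundStateRigidity` — the cell insertion bound.** There is an absolute `C_I > 0` such that
for measurable `v` of range `R₀` (`v = 0` beyond `R₀`; anything, e.g. `⊤`, below), every cell scale
`s` with `4 R₀ ≤ s` and `128 (N+1) s³ ≤ L³`: `E₀(N+1, L) ≤ E₀(N, L) + C_I / s²`. Corollary of the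
tree's chemical-potential bound `RigidMomentumBound.InsertionBound.insertionBound_range_two`
(Dyson's Jastrow-dressed insertion) rescaled to the range `s/4` by
`InsertionScaling.insertionBound_of_fixedRange`, and the arithmetic
`120/L² + 13000·N·(s/4)/L³ ≤ 31/s²` under `128 (N+1) s³ ≤ L³`.
[cite: LSSY2005, Thm 2.2 (2.17)–(2.26)] -/
theorem stub_cellInsertion :
    ∃ C_I : ℝ, 0 < C_I ∧ ∀ (N : ℕ) (v : ℝ → ℝ≥0∞) (L R₀ s : ℝ), Measurable v → 0 ≤ R₀ →
      (∀ r : ℝ, R₀ < r → v r = 0) → 0 < s → 4 * R₀ ≤ s →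
      128 * ((N : ℝ) + 1) * s ^ 3 ≤ L ^ 3 →
      groundStateEnergy v (N + 1) L ≤ groundStateEnergy v N L + ENNReal.ofReal (C_I / s ^ 2) := by
  refine ⟨31, by norm_num, fun N v L R₀ s hv _ hvR hs hRs hNL => ?_⟩
  have hL : 0 < L := pos_of_density hs hNL
  have hc : 0 < s / 4 := by positivity
  have hvc : ∀ r, s / 4 < r → v r = 0 := fun r hr => hvR r (by linarith)
  exact (insertionBound_range hv hc hvc N hL (density_of_cell hs hNL)).trans
    (add_le_add_right (ENNReal.ofReal_le_ofReal (numeric_bound hs hL hNL)) _)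

end Summit.AtomisticToContinuum.BoseEinsteinCondensation.Theorems.GroundStateRigidity

end
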